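import Summits.ResolutionOfSingularities.ResolutionOfSingularities.Theorems.FrobeniusLadderFRationalResolutionSingBlowupEntryLogRegular
import HarnessLib

/-!
# Crux `FrobeniusLadder.FRationalResolution` (stmt-ResolutionOfSingularities-15317), line `redirect`,
# stub `stub_diagonalizableQuotientResolution` — **A FINITE ÉTALE ATLAS OF SHARP RANK-TWO LOG REGULAR CHARTS AT THE
# SINGULAR POINTS RESOLVES `X`** (design C3 = the rank-2 stratum layer of the non-isolated case, user-facing form:
# the measure bound `D` of `…SingBlowupEntryLogRegular` comes for free from finiteness of the atlas, the normal form of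
# each chart monoid from `…ConeNormalForm`)

**`hasResolution_of_finite_rank_two_atlas`.** `X` integral, locally of finite type over ANY field `k`; finitely many
Noetherian rings `A i` with fs charts `φ i : P i → A i`, `P i ⊆ ℤ²` sharp, Kato-log-regular at every prime; every
SINGULAR point `x ∈ X` has an étale roof `X ←ρ— Y —j↪ Spec (A i)` for some `i`, through `x`, landing at a prime
containing all non-trivial monomials. THEN `Scheme.HasResolution X` — by iterating the blowing up of the reduced singular
locus (`…SingBlowupInduction`), over every field, in every dimension, along singular strata of any dimension.
Example: `X` étale-locally `(rational double point cone 𝔸²/μ_d or any 2-dimensional toric cone) × 𝔸^m`, and twisted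
forms thereof over imperfect fields.

Honest label: assembly toward ONE leaf stub (no stub, crux or summit closed); not the stub: producing such an atlas
from `hq` at points of sharp rank two, and the strata of sharp rank `≥ 3`, remain. No definitions, no named facts, no
sorry. [cite: Kato1994, Def. (2.1), (7.3), (10.1), (10.3), (10.4)] [cite: KempfEtAl1973, Ch. I §1–§2]
[cite: Fulton1993Toric, §2.2, §2.6] [cite: Liu2002, §8.3.4, (3.11)]
-/

noncomputable section

-- single-problem summit: the doubled namespace component is forced
set_option linter.dupNamespace false

open CategoryTheory CategoryTheory.Limits AlgebraicGeometry TopologicalSpace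
open IsLocalRing Literature.AlgebraicGeometry.Resolution Literature.AlgebraicGeometry.Resolution.LogChart
open Summit.ResolutionOfSingularities.ResolutionOfSingularities.Theorems.FRationalResolution

namespace Summit.ResolutionOfSingularities.ResolutionOfSingularities.Theorems.FRationalResolution.SingBlowupAtlas

set_option maxHeartbeats 800000 in
/-- **A finite étale atlas of sharp rank-two log regular charts at the singular points resolves `X`.** See the module
docstring. [cite: Kato1994, Def. (2.1), (7.3), (10.1), (10.3), (10.4)] [cite: KempfEtAl1973, Ch. I §1–§2] -/
theorem hasResolution_of_finite_rank_two_atlas {k : Type} [Field k] (X : Scheme.{0}) [IsIntegral X]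
    (f : X ⟶ Spec (.of k)) [LocallyOfFiniteType f] {ι : Type} [Finite ι] (A : ι → Type)
    [∀ i, CommRing (A i)] [∀ i, IsNoetherianRing (A i)] (P : ι → AddSubmonoid (Fin 2 → ℤ))
    (φ : ∀ i, Multiplicative (P i) →* A i) (hP : ∀ i, (P i).FG)
    (hsat : ∀ i, ∀ (w : Fin 2 → ℤ) (k : ℕ), 0 < k → k • w ∈ P i → w ∈ P i)
    (hspanP : ∀ i, Submodule.span ℤ (P i : Set (Fin 2 → ℤ)) = ⊤)
    (hsharp : ∀ i, ∀ p ∈ P i, -p ∈ P i → p = 0)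
    (hreg : ∀ i, ∀ (𝔮 : Ideal (A i)) [𝔮.IsPrime], IsLogRegularAt (P i) (φ i) 𝔮)
    (H : ∀ x : X, x ∉ Scheme.regularLocus X →
      ∃ (i : ι) (Y : Scheme.{0}) (ρ : Y ⟶ X) (_ : Etale ρ) (j : Y ⟶ Spec (.of (A i))) (_ : IsOpenImmersion j)
        (y : Y), ρ y = x ∧ ∀ p : P i, (p : Fin 2 → ℤ) ≠ 0 → φ i (Multiplicative.ofAdd p) ∈ (j y).asIdeal) :
    Scheme.HasResolution X := by
  classical
  haveI : Fintype ι := Fintype.ofFinite ι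
  -- the normal form of each chart monoid and the uniform measure bound
  choose u e d a had hind hspan hmem using
    fun i => ConeNormalForm.exists_normalForm (P i) (hP i) (hsat i) (hspanP i) (hsharp i)
  refine SingBlowupEntryLogRegular.hasResolution_of_rank_two_logRegular_charts (Finset.univ.sup d) X f
    fun x hx => ?_
  obtain ⟨i, Y, ρ, _, j, _, y, hρy, hface⟩ := H x hx
  have hL := ConeChartEntry.span_faceMonoid_eq_bot (P := P i) (φ := φ i) (𝔭 := (j y).asIdeal) hface
  refine ⟨A i, inferInstance, inferInstance, P i, φ i, (j y).asIdeal, inferInstance, u i, e i, a i, d i, had i,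
    Finset.le_sup (Finset.mem_univ i), hP i, hsat i, hspanP i, hface, fun w => ?_, fun g hg m l h => ?_,
    fun w => ?_, Y, ρ, inferInstance, j, inferInstance, y, hρy, rfl, fun y' 𝔮 _ _ => hreg i 𝔮⟩
  · rw [hmem i w]
    constructor
    · rintro ⟨m, l, hl, hml, rfl⟩
      exact ⟨0, Submodule.zero_mem _, m, l, hl, hml, by rw [zero_add]⟩
    · rintro ⟨g, hg, m, l, hl, hml, rfl⟩
      exact ⟨m, l, hl, hml, by rw [hL g hg, zero_add]⟩
  · rw [hL g hg, zero_add] at h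
    exact hind i m l h
  · obtain ⟨m, l, rfl⟩ := hspan i w
    exact ⟨0, Submodule.zero_mem _, m, l, by rw [zero_add]⟩

end Summit.ResolutionOfSingularities.ResolutionOfSingularities.Theorems.FRationalResolution.SingBlowupAtlas

end
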